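import Summits.ResolutionOfSingularities.ResolutionOfSingularities.Theorems.LossEntryW26
import HarnessLib

/-!
# LossEntryW29 — decomp-res lens-3 g29 «LossEntryWalk», landing part 29 (slice 21): a staying move evaluates the
in-wall slice to zero; the degenerate in-wall position cannot stay

Residual `stmt-ResolutionOfSingularities-27367`.  Imports part 26; independent of parts 12–24, 27, 28.

* `eval_wall_slice_of_stays` — the engine of `LossEntryW26.b_eq_root_of_wall_pure_stays` with the pure power
  replaced by an ARBITRARY in-wall form `P` (support in degree `s`, no `u_a`): at a one-wall state `u` (boundary
  `M·e_a`, shade `s ≥ 1`, order `s+M > q`) moving in the chart `b ≠ a` with a shade plateau and STAYING on the wall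
  (`b_u(a) = 0`), if the in-wall slice of the lowest layer is `φ₀·P` with `φ₀ ≠ 0` then `P(·, 1, b_u(c)) = 0`
  (the constant term of the residual form — a form of degree `s ≥ 1` by `cone_of_plateau` — is `φ₀·P(·,1,b_u(c))`);
* `wall_axis_not_stays` — hence the DEGENERATE position of `LossEntryW28` (in-wall slice `φ₀·u_b^s`, `b` the chart
  letter) forces the move to LEAVE the wall: `b_u(a) ≠ 0` (as `u_b^s(·,1,·) = 1 ≠ 0`).

With parts 25–28 this completes the case list of the forward propagation of in-wall purity along a one-wall tail
(NODE-g29 §3ter): every staying move points at the in-wall root, and the degenerate position never stays.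

Tree tools only; complete proofs, standard axioms.

(Sources: Hauser2010 §F; HauserPerlega2019 §2; CossartJannsenSaito2020 Ch. 8; Moh1987; Perlega2022.)
-/

open MvPolynomial Finset
open Literature.AlgebraicGeometry.Resolution
open Literature.AlgebraicGeometry.Resolution.Hauser2010
open Literature.AlgebraicGeometry.Resolution.PointBlowup
open Summit.ResolutionOfSingularities.ResolutionOfSingularities.Theorems.TightDefectClasses
open Summit.ResolutionOfSingularities.ResolutionOfSingularities.Theorems.TightDefectStrongWalks
open Summit.ResolutionOfSingularities.ResolutionOfSingularities.Theorems.ItineraryCutClasses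
open Summit.ResolutionOfSingularities.ResolutionOfSingularities.Theorems.BoundaryLedger
open Summit.ResolutionOfSingularities.ResolutionOfSingularities.Theorems.ProximityCut
open Summit.ResolutionOfSingularities.ResolutionOfSingularities.Theorems.ConeCut
open Summit.ResolutionOfSingularities.ResolutionOfSingularities.Theorems.LossExitCone

namespace Summit.ResolutionOfSingularities.ResolutionOfSingularities.Theorems.LossPolygon

section WallStayGeneral

variable {K : Type} [Field K] [DecidableEq K] {q : ℕ} {s₀ : State (Fin 3) K}

/-- **A staying move evaluates the in-wall slice to zero (PROVED).**  See the module docstring. [new] [folklore] -/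
theorem eval_wall_slice_of_stays (hroot : IsRoot q s₀) (W : ForcedWalk q s₀) (u : ℕ) {a b c : Fin 3}
    (hab : a ≠ b) (hac : a ≠ c) (hbc : b ≠ c) (hj : W.j u = b) {M s : ℕ} (hs1 : 1 ≤ s)
    (hr : (W.st u).r = Finsupp.single a M) (hsh : (W.st u).shade = (s : ℕ∞))
    (hplat : (W.st (u + 1)).shade = (W.st u).shade) (hq : q < s + M) (hga : W.b u a = 0) {φ₀ : K}
    (hφ₀ : φ₀ ≠ 0) {P : MvPolynomial (Fin 3) K} (hPs : ∀ E ∈ P.support, E.degree = s ∧ E a = 0)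
    (hwall : ∀ E : Fin 3 →₀ ℕ, E.degree = s → E a = 0 →
      coeff ((W.st u).r + E) (W.st u).F = φ₀ * coeff E P) :
    eval (fun l => if l = c then W.b u c else 1) P = 0 := by
  classical
  obtain ⟨o, ho, -⟩ := walk_nat hroot W u
  obtain ⟨n, hn, hon⟩ := order_eq_shade_add_degree hroot W u ho
  have hns : n = s := by
    have h := hsh
    rw [hn] at h
    exact_mod_cast h
  subst hns
  have hrdeg : (W.st u).r.degree = M := by rw [hr, Finsupp.degree_single]
  rw [hrdeg] at hon
  subst hon
  have hqo : q < n + M := hq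
  have hcone := (cone_of_plateau hroot W u ho hqo hplat hn).1
  -- the constant term of the residual form vanishes
  have h0 : coeff 0 (resForm W u (n + M)) = 0 :=
    hcone.coeff_eq_zero (by rw [map_zero]; omega)
  unfold resForm at h0
  rw [coeff_zero_translate, hj] at h0
  -- evaluate the residual layer at `b_u` through the in-wall slice
  set g : Fin 3 → K := W.b u with hg
  set A := ((W.st u).F.support.filter fun d => d.degree = n + M).filter (fun d => d a = M) with hA
  have hwr := walk_r hroot W u
  have hev : eval g (resLayer b (W.st u) (n + M)) = ∑ d ∈ A, coeff d (W.st u).F * g c ^ (d c) := by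
    unfold resLayer
    rw [map_sum]
    conv_rhs => rw [hA, Finset.sum_filter]
    refine Finset.sum_congr rfl fun d hd => ?_
    have hdF : d ∈ (W.st u).F.support := (Finset.mem_filter.mp hd).1
    have hrd : (W.st u).r ≤ d := hwr d hdF
    have hMd : M ≤ d a := by have := hrd a; rwa [hr, Finsupp.single_eq_same] at this
    rw [eval_monomial, Finsupp.prod_fintype _ _ (fun i => pow_zero _), prod_univ_fin3 hab hac hbc,
      update_apply', if_neg hab, update_apply', if_pos rfl, update_apply', if_neg (Ne.symm hbc),
      Finsupp.tsub_apply, Finsupp.tsub_apply, hr, Finsupp.single_eq_same, Finsupp.single_eq_of_ne hac.symm,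
      Nat.sub_zero, pow_zero, mul_one]
    by_cases hda : d a = M
    · rw [if_pos hda, hda, Nat.sub_self, pow_zero, one_mul]
    · rw [if_neg hda, hga, zero_pow (by omega), zero_mul, mul_zero]
  -- the in-wall slice rewrites the sum through `P`
  set f : (Fin 3 →₀ ℕ) → K := fun E => coeff E P * g c ^ (E c) with hf
  have hterm : ∀ d ∈ A, coeff d (W.st u).F * g c ^ (d c) = φ₀ * f (d - (W.st u).r) := by
    intro d hd
    obtain ⟨hd1, hda⟩ := Finset.mem_filter.mp hd
    obtain ⟨hdF, hdeg⟩ := Finset.mem_filter.mp hd1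
    have hrd : (W.st u).r ≤ d := hwr d hdF
    have hE : d = (W.st u).r + (d - (W.st u).r) := (add_tsub_cancel_of_le hrd).symm
    have hEdeg : (d - (W.st u).r).degree = n := by
      have h := congrArg Finsupp.degree hE
      rw [map_add, hrdeg, hdeg] at h
      omega
    have hEa : (d - (W.st u).r) a = 0 := by
      rw [Finsupp.tsub_apply, hr, Finsupp.single_eq_same, hda, Nat.sub_self]
    have hEc : (d - (W.st u).r) c = d c := by
      rw [Finsupp.tsub_apply, hr, Finsupp.single_eq_of_ne hac.symm, Nat.sub_zero]
    rw [hf]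
    simp only
    rw [hEc, ← mul_assoc, ← hwall _ hEdeg hEa, ← hE]
  rw [hev, Finset.sum_congr rfl hterm, ← Finset.mul_sum] at h0
  -- reindex: `d ↦ d − r` is injective on `A`, and its image carries the whole support of `P`
  have hinj : Set.InjOn (fun d => d - (W.st u).r) A := by
    intro d hd d' hd' h
    have hrd : (W.st u).r ≤ d := hwr d (Finset.mem_filter.mp (Finset.mem_filter.mp hd).1).1
    have hrd' : (W.st u).r ≤ d' := hwr d' (Finset.mem_filter.mp (Finset.mem_filter.mp hd').1).1
    have := congrArg (fun E => (W.st u).r + E) h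
    simp only at this
    rwa [add_tsub_cancel_of_le hrd, add_tsub_cancel_of_le hrd'] at this
  rw [← Finset.sum_image hinj] at h0
  set A' := A.image (fun d => d - (W.st u).r) with hA'
  have hsum : ∑ E ∈ A', f E = ∑ E ∈ P.support, f E := by
    have h1 : ∑ E ∈ A', f E = ∑ E ∈ A' ∪ P.support, f E := by
      refine Finset.sum_subset Finset.subset_union_left fun E hEU hEA => ?_
      rw [hf]
      simp only
      rcases Finset.mem_union.mp hEU with h | hEP
      · exact absurd h hEA
      · exfalso
        apply hEA
        obtain ⟨hEdeg, hEa⟩ := hPs E hEP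
        have hcoef : coeff ((W.st u).r + E) (W.st u).F ≠ 0 := by
          rw [hwall E hEdeg hEa]
          exact mul_ne_zero hφ₀ (MvPolynomial.mem_support_iff.mp hEP)
        refine Finset.mem_image.mpr ⟨(W.st u).r + E, ?_, add_tsub_cancel_left _ _⟩
        refine Finset.mem_filter.mpr ⟨Finset.mem_filter.mpr ⟨MvPolynomial.mem_support_iff.mpr hcoef, ?_⟩, ?_⟩
        · rw [map_add, hrdeg, hEdeg, add_comm]
        · rw [Finsupp.add_apply, hr, Finsupp.single_eq_same, hEa, add_zero]
    have h2 : ∑ E ∈ P.support, f E = ∑ E ∈ A' ∪ P.support, f E := by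
      refine Finset.sum_subset Finset.subset_union_right fun E _ hEP => ?_
      rw [hf]
      simp only
      rw [MvPolynomial.notMem_support_iff.mp hEP, zero_mul]
    rw [h1, h2]
  rw [hsum] at h0
  -- the last sum is the value of `P` at `(1, 1, g c)`
  have hval : ∑ E ∈ P.support, f E = eval (fun l => if l = c then W.b u c else 1) P := by
    rw [eval_eq']
    refine Finset.sum_congr rfl fun E _ => ?_
    rw [hf]
    simp only
    rw [prod_univ_fin3 hab hac hbc, if_neg hac, if_neg hbc, if_pos rfl, one_pow, one_pow, one_mul, one_mul]
  rw [hval] at h0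
  exact (mul_eq_zero.mp h0).resolve_left hφ₀

/-- **The degenerate in-wall position cannot stay (PROVED).**  At a one-wall state `u` (boundary `M·e_a`, shade
`s ≥ 1`, order `s+M > q`) moving in the chart `b ≠ a` with a shade plateau: if the in-wall slice of the lowest
layer is `φ₀·u_b^s` with `φ₀ ≠ 0` then the move LEAVES the wall, `b_u(a) ≠ 0` — so `LossEntryW28.wall_axis_succ`
always applies in this position. [new] [folklore] -/
theorem wall_axis_not_stays (hroot : IsRoot q s₀) (W : ForcedWalk q s₀) (u : ℕ) {a b c : Fin 3}
    (hab : a ≠ b) (hac : a ≠ c) (hbc : b ≠ c) (hj : W.j u = b) {M s : ℕ} (hs1 : 1 ≤ s)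
    (hr : (W.st u).r = Finsupp.single a M) (hsh : (W.st u).shade = (s : ℕ∞))
    (hplat : (W.st (u + 1)).shade = (W.st u).shade) (hq : q < s + M) {φ₀ : K} (hφ₀ : φ₀ ≠ 0)
    (hwall : ∀ E : Fin 3 →₀ ℕ, E.degree = s → E a = 0 →
      coeff ((W.st u).r + E) (W.st u).F = φ₀ * coeff E (X b ^ s)) :
    W.b u a ≠ 0 := by
  classical
  intro hga
  have hPs : ∀ E ∈ (X b ^ s : MvPolynomial (Fin 3) K).support, E.degree = s ∧ E a = 0 := by
    intro E hE
    rw [X_pow_eq_monomial, support_monomial, if_neg one_ne_zero, Finset.mem_singleton] at hE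
    rw [hE, Finsupp.degree_single, Finsupp.single_eq_of_ne hab]
    exact ⟨rfl, rfl⟩
  have h := eval_wall_slice_of_stays hroot W u hab hac hbc hj hs1 hr hsh hplat hq hga hφ₀ hPs hwall
  rw [map_pow, eval_X, if_neg hbc, one_pow] at h
  exact one_ne_zero h

end WallStayGeneral

end Summit.ResolutionOfSingularities.ResolutionOfSingularities.Theorems.LossPolygon
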